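import Summits.QuantumFields.YangMills.Theorems.CoarseStiffnessTailCappedCoarseStiffnessLCornerCombFamily
import Literature.MathematicalPhysics.QuantumFieldTheory.Balaban1983to89.T4PlaqDisjointFamilies

/-!
# Route `CoarseStiffnessTail` — THE CORNER-COMB BOUND `Z_P(β) ≤ linkMass(β)^{(d−1)(|T|−1)}` (part 2 of 2: the count and the bound)
# (lead's certificate, seat `ym-line-cst-p1` g15; helper on 25301 `CappedCoarseStiffnessL`, stub S3 = uniform mean action)

THE COUNT (`card_cornerComb`).  The pivots of the corner-comb family of `…LCornerCombFamily` (plaquettes `⟨x, μ, ν⟩` with `x_i = −1` for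
`i < μ` and (`x_μ ≠ −1`, pivot `⟨x, ν⟩`) or (`x_i = −1` for `i < ν`, `x_ν ≠ −1`, pivot `⟨x, μ⟩`)) are EXACTLY the bonds `⟨x, δ⟩` with
`x ≠ c* = (−1,…,−1)` and `δ ≠ k(x)` (the least non-corner direction) (`image_pivot_eq`); the complement consists of the `d` corner bonds and
the `|T| − 1` comb-tree bonds `⟨x, k(x)⟩` (`card_cornerBonds`, `card_combTree`), so by injectivity of the pivot
`#𝔉 = d|T| − d − (|T| − 1) = (d−1)(|T|−1)`.

THE BOUND (`partitionFn_le_linkMass_pow_cornerComb`, any regular gauge group, any `Params`, `β ≥ 0`): `Z_P(β) ≤ linkMass(β)^{(d−1)(|T|−1)}`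
by `CoarseStiffnessTailPivotPeeling.partitionFn_le_linkMass_pow_of_peelable`; `log_partitionFn_le_cornerComb`: `log Z_P(β) ≤
(d−1)(|T|−1)·log linkMass(β)`.  With the one-plaquette Laplace bound `log linkMass_{SU(N)}(β) ≤ −((N²−1)/2)·log β + log(D_N T_N)` of the tree
this is the Gaussian UPPER bound on `log Z_P` with no `|T|/n` loss (the N13 axial tree had `(d−1)(1 − 1/n)|T|` pivots); by Euler
characteristic of the torus `(d−1)(|T|−1)` is the maximum number of private pivots of any family.

HONEST SCOPE.  Finite combinatorics + the peeling theorem; nothing of Bałaban's is asserted; the crux 25301, its stubs S1/S2/S3,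
`HistoryTailL` 19936 stay OPEN; `YM3TorusSU2` (R3, RECORD rung, not Clay) is NOT proved; the Yang–Mills mass gap is NOT touched.

References: I. Montvay, G. Münster, *Quantum Fields on a Lattice* (1994) §3.2.5 [MontvayMunster1994]; T. Bałaban, CMP **102** (1985)
255–275 [Balaban1985UV3] ((1)–(3) p.256).
-/

noncomputable section

open MeasureTheory
open scoped ENNReal BigOperators

namespace Summit.QuantumFields.YangMills.Theorems.CoarseStiffnessTailCornerCombBound

open Literature.MathematicalPhysics.QuantumFieldTheory.Balaban1983to89 Literature.MathematicalPhysics.QuantumFieldTheory.Balaban1983to89.Missing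
open Summit.QuantumFields.BalabanUV.T4Continuum.NE7b.BarePartitionFnDecay (linkMass linkMass_nonneg)
open Summit.QuantumFields.YangMills.Theorems.CoarseStiffnessTailPivotPeeling (partitionFn_le_linkMass_pow_of_peelable)
open Summit.QuantumFields.YangMills.Theorems.CoarseStiffnessTailCornerCombFamily
  (leastDir_unique exists_leastDir memW_elim pivot_is_link pivot_injOn rank_lt_of_pivot_mem)

variable (P : Params)

/-! ## §4 The pivots of the family are the bonds `⟨x, δ⟩`, `x ≠ c*`, `δ ≠ k(x)`; the count `(d−1)(|T|−1)` -/

section Count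

/-- The image of the family under the pivot map: all bonds `⟨x, δ⟩` with `x ≠ c*` and `δ` not the least non-corner direction of `x`.
[folklore] -/
theorem image_pivot_eq [DecidableEq (PBond P 0)] :
    (Finset.univ.filter fun p : Plaq P 0 =>
        (∀ i, i < p.μ → p.src i = -1) ∧ (p.src p.μ ≠ -1 ∨ ((∀ i, i < p.ν → p.src i = -1) ∧ p.src p.ν ≠ -1))).image
      (fun p : Plaq P 0 => if p.src p.μ = -1 then (⟨p.src, p.μ⟩ : PBond P 0) else ⟨p.src, p.ν⟩) =
    Finset.univ.filter fun b : PBond P 0 =>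
      b.src ≠ (fun _ => -1) ∧ ¬ ((∀ i, i < b.dir → b.src i = -1) ∧ b.src b.dir ≠ -1) := by
  ext b
  simp only [Finset.mem_image, Finset.mem_filter, Finset.mem_univ, true_and]
  constructor
  · rintro ⟨p, hp, hpb⟩
    by_cases hW : p.src p.μ = -1
    · rw [if_pos hW] at hpb
      subst hpb
      obtain ⟨hW1, hWν⟩ := memW_elim P hp hW
      refine ⟨fun hc => hWν (by have hc' : p.src = fun _ => -1 := hc; rw [hc']), fun ⟨_, h2⟩ => h2 hW⟩
    · rw [if_neg hW] at hpb
      subst hpb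
      refine ⟨fun hc => hW (by have hc' : p.src = fun _ => -1 := hc; rw [hc']), fun ⟨h1, _⟩ => hW (h1 p.μ p.hμν)⟩
  · rintro ⟨hx, hnot⟩
    obtain ⟨k, hk1, hk2⟩ := exists_leastDir P b.src hx
    have hkδ : k ≠ b.dir := by
      rintro rfl; exact hnot ⟨hk1, hk2⟩
    rcases lt_or_gt_of_ne hkδ with hlt | hgt
    · -- F-type member `⟨x, k, δ⟩`
      refine ⟨⟨b.src, k, b.dir, hlt⟩, ⟨hk1, Or.inl hk2⟩, ?_⟩
      simp only
      rw [if_neg hk2]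
    · -- W-type member `⟨x, δ, k⟩`
      have hδ : b.src b.dir = -1 := hk1 b.dir hgt
      refine ⟨⟨b.src, b.dir, k, hgt⟩, ⟨fun i hi => hk1 i (lt_trans hi hgt), Or.inr ⟨hk1, hk2⟩⟩, ?_⟩
      simp only
      rw [if_pos hδ]

/-- The comb tree `{⟨x, k(x)⟩ : x ≠ c*}` has `|T| − 1` bonds (`b ↦ src b` is a bijection onto `{x ≠ c*}`). [folklore] -/
theorem card_combTree :
    (Finset.univ.filter fun b : PBond P 0 => (∀ i, i < b.dir → b.src i = -1) ∧ b.src b.dir ≠ -1).card =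
      Fintype.card (Site P 0) - 1 := by
  classical
  have hcorner : (Finset.univ.filter fun x : Site P 0 => x ≠ fun _ => -1).card = Fintype.card (Site P 0) - 1 := by
    rw [Finset.filter_ne' Finset.univ, Finset.card_erase_of_mem (Finset.mem_univ _), Finset.card_univ]
  rw [← hcorner]
  refine Finset.card_bij (fun b _ => b.src) ?_ ?_ ?_
  · intro b hb
    obtain ⟨_, h2⟩ := (Finset.mem_filter.1 hb).2
    exact Finset.mem_filter.2 ⟨Finset.mem_univ _, fun hc => h2 (by rw [hc])⟩
  · intro b hb b' hb' h
    obtain ⟨h1, h2⟩ := (Finset.mem_filter.1 hb).2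
    obtain ⟨h1', h2'⟩ := (Finset.mem_filter.1 hb').2
    have hsrc : b.src = b'.src := h
    rw [hsrc] at h1 h2
    have hdir : b.dir = b'.dir := leastDir_unique P b'.src h1 h2 h1' h2'
    obtain ⟨s, δ⟩ := b; obtain ⟨s', δ'⟩ := b'
    simp only at hsrc hdir; subst hsrc; subst hdir; rfl
  · intro x hx
    obtain ⟨k, hk1, hk2⟩ := exists_leastDir P x (Finset.mem_filter.1 hx).2
    exact ⟨⟨x, k⟩, Finset.mem_filter.2 ⟨Finset.mem_univ _, hk1, hk2⟩, rfl⟩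

/-- The `d` corner bonds `⟨c*, δ⟩`. [folklore] -/
theorem card_cornerBonds :
    (Finset.univ.filter fun b : PBond P 0 => b.src = fun _ => -1).card = P.d := by
  classical
  have h : (Finset.univ.filter fun b : PBond P 0 => b.src = fun _ => -1) =
      (Finset.univ : Finset (Fin P.d)).image fun δ => (⟨fun _ => -1, δ⟩ : PBond P 0) := by
    ext b
    simp only [Finset.mem_filter, Finset.mem_univ, true_and, Finset.mem_image]
    constructor
    · intro hb; exact ⟨b.dir, by obtain ⟨s, δ⟩ := b; simp only at hb; subst hb; rfl⟩
    · rintro ⟨δ, rfl⟩; rfl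
  rw [h, Finset.card_image_of_injective _ (fun δ δ' hδ => congrArg PBond.dir hδ), Finset.card_univ, Fintype.card_fin]

/-- **★ THE COUNT**: the corner-comb family has `(d−1)(|T|−1)` members. [folklore] -/
theorem card_cornerComb :
    (Finset.univ.filter fun p : Plaq P 0 =>
        (∀ i, i < p.μ → p.src i = -1) ∧ (p.src p.μ ≠ -1 ∨ ((∀ i, i < p.ν → p.src i = -1) ∧ p.src p.ν ≠ -1))).card =
      (P.d - 1) * (Fintype.card (Site P 0) - 1) := by
  classical
  set 𝔉 := Finset.univ.filter fun p : Plaq P 0 =>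
    (∀ i, i < p.μ → p.src i = -1) ∧ (p.src p.μ ≠ -1 ∨ ((∀ i, i < p.ν → p.src i = -1) ∧ p.src p.ν ≠ -1)) with h𝔉
  have hinj : Set.InjOn (fun p : Plaq P 0 => if p.src p.μ = -1 then (⟨p.src, p.μ⟩ : PBond P 0) else ⟨p.src, p.ν⟩)
      (𝔉 : Set (Plaq P 0)) := by
    intro p hp q hq h
    exact pivot_injOn P (Finset.mem_filter.1 (Finset.mem_coe.1 hp)).2 (Finset.mem_filter.1 (Finset.mem_coe.1 hq)).2 h
  rw [← Finset.card_image_of_injOn hinj, h𝔉, image_pivot_eq P]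
  -- complement count inside `PBond`
  set Q : Finset (PBond P 0) := Finset.univ.filter fun b : PBond P 0 =>
    b.src ≠ (fun _ => -1) ∧ ¬ ((∀ i, i < b.dir → b.src i = -1) ∧ b.src b.dir ≠ -1) with hQ
  set C : Finset (PBond P 0) := Finset.univ.filter fun b : PBond P 0 => b.src = fun _ => -1 with hC
  set E : Finset (PBond P 0) := Finset.univ.filter fun b : PBond P 0 =>
    (∀ i, i < b.dir → b.src i = -1) ∧ b.src b.dir ≠ -1 with hE
  have hCE : Disjoint C E := by
    rw [Finset.disjoint_left]
    intro b hbC hbE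
    have h1 : b.src = fun _ => -1 := (Finset.mem_filter.1 hbC).2
    have h2 := (Finset.mem_filter.1 hbE).2.2
    exact h2 (by rw [h1])
  have hQc : Q = Finset.univ \ (C ∪ E) := by
    ext b
    simp only [hQ, hC, hE, Finset.mem_filter, Finset.mem_univ, true_and, Finset.mem_sdiff, Finset.mem_union, not_or]
  have hcardQ : Q.card = Fintype.card (PBond P 0) - (C.card + E.card) := by
    rw [hQc, Finset.card_sdiff_of_subset (Finset.subset_univ _), Finset.card_univ, Finset.card_union_of_disjoint hCE]
  rw [hcardQ, hC, card_cornerBonds P, hE, card_combTree P,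
    Literature.MathematicalPhysics.QuantumFieldTheory.Balaban1983to89.T4PlaqDisjointFamilies.card_pbond P 0]
  have hT : 1 ≤ Fintype.card (Site P 0) := Fintype.card_pos
  have hd : 1 ≤ P.d := P.hd
  -- `T·d − (d + (T − 1)) = (d − 1)(T − 1)` in `ℕ`
  obtain ⟨T', hT'⟩ : ∃ T', Fintype.card (Site P 0) = T' + 1 := ⟨_, (Nat.succ_pred_eq_of_pos hT).symm⟩
  obtain ⟨d', hd'⟩ : ∃ d', P.d = d' + 1 := ⟨_, (Nat.succ_pred_eq_of_pos hd).symm⟩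
  rw [hT', hd']
  simp only [Nat.add_sub_cancel]
  have : (T' + 1) * (d' + 1) = d' * T' + (d' + 1 + T') := by ring
  rw [this, Nat.add_sub_cancel]

end Count

/-! ## §5 The bound `Z_P(β) ≤ linkMass(β)^{(d−1)(|T|−1)}` -/

section Bound

variable {G : Type*} [GaugeGroup G] [MeasurableSpace G] [HaarData G] [RegularGaugeGroup G]

/-- **★★★ `Z_P(β) ≤ linkMass(β)^{(d−1)(|T₁^{(0)}|−1)}`** for every `Params`, every regular gauge group and `β ≥ 0`: the corner-comb family is
peelable (§3) with `(d−1)(|T|−1)` members (§4); apply `CoarseStiffnessTailPivotPeeling.partitionFn_le_linkMass_pow_of_peelable`. [folklore] -/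
theorem partitionFn_le_linkMass_pow_cornerComb {β : ℝ} (hβ : 0 ≤ β) :
    partitionFn (G := G) P β ≤ linkMass (G := G) β ^ ((P.d - 1) * (Fintype.card (Site P 0) - 1)) := by
  classical
  rw [← card_cornerComb P]
  refine partitionFn_le_linkMass_pow_of_peelable P hβ _
    (fun p : Plaq P 0 => if p.src p.μ = -1 then (⟨p.src, p.μ⟩ : PBond P 0) else ⟨p.src, p.ν⟩)
    (fun p : Plaq P 0 => p.μ.val * ((P.d + 1) * P.sitesPerDir 0) +
      (if p.src p.μ = -1 then p.ν.val * P.sitesPerDir 0 + (p.src p.ν).val else P.d * P.sitesPerDir 0 + (p.src p.μ).val))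
    (fun p _ => pivot_is_link P p) ?_ ?_
  · intro p hp q hq h
    exact pivot_injOn P (Finset.mem_filter.1 (Finset.mem_coe.1 hp)).2 (Finset.mem_filter.1 (Finset.mem_coe.1 hq)).2 h
  · intro p hp q hq hne hmem
    exact rank_lt_of_pivot_mem P (Finset.mem_filter.1 hp).2 (Finset.mem_filter.1 hq).2 hne hmem

/-- **★★★ LOGARITHMIC FORM**: `log Z_P(β) ≤ (d − 1)·(|T₁^{(0)}| − 1)·log linkMass(β)` (`β ≥ 0`).  With the one-plaquette Laplace bound
`log linkMass_{SU(N)} β ≤ −((N²−1)/2) log β + log(D_N T_N)` this is the Gaussian upper bound with no `|T|/n` loss. [folklore] -/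
theorem log_partitionFn_le_cornerComb {β : ℝ} (hβ : 0 ≤ β) :
    Real.log (partitionFn (G := G) P β) ≤
      ((P.d : ℝ) - 1) * ((Fintype.card (Site P 0) : ℝ) - 1) * Real.log (linkMass (G := G) β) := by
  have hZ : 0 < partitionFn (G := G) P β := partitionFn_pos' P hβ
  have h := Real.log_le_log hZ (partitionFn_le_linkMass_pow_cornerComb P hβ)
  rw [Real.log_pow] at h
  have hT : 1 ≤ Fintype.card (Site P 0) := Fintype.card_pos
  have hcast : (((P.d - 1) * (Fintype.card (Site P 0) - 1) : ℕ) : ℝ) = ((P.d : ℝ) - 1) * ((Fintype.card (Site P 0) : ℝ) - 1) := by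
    rw [Nat.cast_mul, Nat.cast_sub P.hd, Nat.cast_sub hT]; norm_num
  rwa [hcast] at h

end Bound

end Summit.QuantumFields.YangMills.Theorems.CoarseStiffnessTailCornerCombBound

end
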